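import Summits.QuantumFields.YangMills.Theorems.UnitScaleTiltCoverSites
import Summits.QuantumFields.YangMills.Theorems.UnitScaleTiltProp8FlatCubeOpsText
import HarnessLib

/-!
# Route `UnitScaleTilt`, crux K1 child «MinimiserStabilityRegPr» (stmt-QuantumFields-19200), registered stub `stub_halvingStep` (H), branch (P2-small),
# OWNER RULING g26-№18 mechanism of record **(α) COVERING ∕ PERIODISATION** — brick **α2 `CoverDomains`**: THE NESTED FAMILY, ITS TERRITORIES, INDEX BONDS,
# LEVEL WEIGHTS, ADMISSIBILITY (2.1)–(2.2) AND THE DISTANCE OF (161) ALL LIFT ALONG THE `L^{jc}`-FOLD COVERING MAP `proj` OF α1 (`CoverSites`)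

Cell `ym3-torus` (HUMAN RULING D-0037, YM ladder rung R3 — continuum SU(2) YM₃ on the torus is a RUNG, not the Clay problem), width seat `ym-ust-20520-w1` gen 5,
typed from LEAD `ym-ust-19200-w5` g3's plan `H-SMALL-PLAN-w5g3.md` §3–§4 (evidence #54 of stmt-QuantumFields-19200) against ★w8-19936 g0's α1.
`--supports stmt-QuantumFields-19200 --as helper`; 0 sorry, standard axioms; two definitions (`Domains.comap`, `projIdx`; plus the lift `liftIdx`), no instance, no notation.

THE PRINT.  [Balaban1984PropagatorsII] p. 224: the operators of Sect. 2 live on a nested family `Ω₁ ⊃ Ω₂ ⊃ … ⊃ Ω_k` of unions of big blocks of the tori `T^{(j)}` ((2.1)–(2.3));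
every estimate of [Balaban1984PropagatorsII]∕[Balaban1985Variational] Sect. F is uniform in the torus size.  The tree's port of Cor. 2.8 (`FlatPortBodyL0.body_of_adm22`) fixed a
`□̃³` window of five `L^{a′+2}`-units per direction and therefore carries `a′ + 3 ≤ m + n`; the (α) plan removes it by reading a SMALL member `(m, n, K)` on its `L^{jc}`-fold cover
`(m + jc, n, K)` («wrap-around is harmless» = unwrap to the cover and read periodic data).  THIS FILE is the `Domains` layer of that transfer:
* §1 ★`Domains.comap` (`Ω̃_j^{(j)} := proj_j⁻¹ Ω_j^{(j)}`, same `k`; nested by α1's `proj_blockOf`), `mem_comap_Om`, ★`inOm_comap_iff`, `deep_comap_iff`, `lamSite_comap_iff`,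
  ★`lamBond_comap_iff` — the territories `Λ̃_j` are the preimages of the `Λ_j`;
* §2 ★`projIdx : BondIdx D̃ → BondIdx D` (keep the level, project the bond), `liftIdx`, `projIdx_liftIdx`, `projIdx_surjective`, ★`card_fibre_idx = (L^{jc})^d` (K-FREE — kill
  test k-iv of the plan), ★`sum_idx_cover_eq_sum_fibre` (fibrewise regrouping, the `BondIdx`-side workhorse of α5), `le_sum_fibre_of_nonneg` (one summand ≤ the orbit sum);
* §3 `levOf_congr_of_iff`, ★`levOf_comap` (`j(x̃) = j(proj x̃)`), ★`isLevWeight_comap` (the P2 weights `w̃ m b̃ := w m (projBond b̃)` ARE the level weights of `D̃` for the member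
  `F.cover jc`; `T3Family.cover_P` is `rfl`);
* §4 `sitesPerDir_le_or_dvd` (`M = Lᵃ` either divides the period `2L^s` or exceeds it), `label_proj_eq`, ★★`adm22_comap (hM : ∃ a, M = P.L ^ a) : Adm22 D R M → Adm22 D̃ R M` —
  block-constancy of membership via the labels, separation because a reduction map only shrinks the circular distance (α1's `distSite_proj_le`); NO torus-size hypothesis
  (`M = Lᵃ` is exactly `FlatOpsAdmAtMS`'s `hpow`);
* §5 ★`distBI_proj_le : distBI D (projBond b̃) (projIdx c̃) ≤ distBI D̃ b̃ c̃` and ★`exists_lift_distBI_eq` (the downstairs distance is attained on a lift: α5's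
  `dBI_small := min over the fibre` is admissible, `≥ distBI D`).
HONEST SCOPE: finite-torus bookkeeping (no analysis, no operator); the letters transfer is α3–α5, the `_allSizes` body α6.  NOT a claim about the H stub, the crux, the rung or a mass gap.

References: T. Bałaban, CMP **96** (1984) 223–250 [Balaban1984PropagatorsII] (2.1)–(2.3) p.224; CMP **102** (1985) 277–309 [Balaban1985Variational] p.286 (level weights),
(144) p.300, (152) p.301, (161)–(162) p.303; CMP **99** (1985) 75–102 [Balaban1985RegularSpaces] (1.3)–(1.4) p.77.
-/

set_option autoImplicit false

noncomputable section

open scoped BigOperators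

namespace Summit.QuantumFields.YangMills.Theorems.CoverDomains

open Literature.MathematicalPhysics.QuantumFieldTheory.Balaban1983to89
open B6SectADomainsV1 (Domains)
open B6SectAOperatorsV1 (BondIdx)
open B5Eq118OneStroke (iterBlockOf)
open B5Eq117TorusCarriers (Mk)
open B5Prop12FieldsLattice (distSite distSite_nonneg)
open B11Eq115Space (levOf)
open T3ContinuumYM3Torus (T3Family)
open FlatCubeOpsText (Adm22 distBI IsLevWeight)
open CoverSites (cover proj projBond proj_shift proj_blockOf proj_iterBlockOf projBond_tgt val_proj distSite_proj_le exists_lift_distSite_eq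
  card_fibre_bond)

/-! ## §1 The lifted family `D̃ := π⁻¹D` on the cover and its territories -/

section Comap

variable {P : Params} (D : Domains P) (jc : ℕ)

/-- **THE LIFTED FAMILY `D̃ := π⁻¹ D` ON THE `L^{jc}`-FOLD COVER**: `Ω̃_j^{(j)} := proj_j⁻¹(Ω_j^{(j)})`, same number of levels `k`; nested because `proj` commutes with
`blockOf`. [cite: Balaban1984PropagatorsII, (2.1)-(2.3) p.224] -/
def _root_.Literature.MathematicalPhysics.QuantumFieldTheory.Balaban1983to89.B6SectADomainsV1.Domains.comap : Domains (cover P jc) where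
  k := D.k
  hk := le_trans D.hk (by show P.m + P.K ≤ P.m + jc + P.K; omega)
  Om j := Finset.univ.filter fun x => proj P jc j x ∈ D.Om j
  Om_zero := by
    ext x
    simp [D.Om_zero]
  Om_eq_empty j hj := by
    ext x
    simp [D.Om_eq_empty hj]
  nested j y hy := by
    simp only [Finset.mem_filter, Finset.mem_univ, true_and] at hy ⊢
    by_cases hjk : j + 1 ≤ D.k
    · rw [proj_blockOf P jc j (le_trans hjk D.hk)] at hy
      exact D.nested _ hy
    · rw [D.Om_eq_empty (by omega)] at hy
      simp at hy

/-- the lifted family has the same number of levels. [cite: Balaban1984PropagatorsII, (2.1) p.224] -/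
@[simp] theorem comap_k : (D.comap jc).k = D.k := rfl

/-- membership in `Ω̃_j^{(j)}` is membership of the projection. [cite: Balaban1984PropagatorsII, (2.1) p.224] -/
@[simp] theorem mem_comap_Om (j : ℕ) (x : Site (cover P jc) j) : x ∈ (D.comap jc).Om j ↔ proj P jc j x ∈ D.Om j := by
  simp [Domains.comap]

/-- `x̃ ∈ B^j(Ω̃_j) ↔ proj x̃ ∈ B^j(Ω_j)` at every level `j` (idle levels `j > k` are empty on both sides). [cite: Balaban1984PropagatorsII, (2.1)-(2.3) p.224] -/
theorem inOm_comap_iff (j : ℕ) (x : Site (cover P jc) 0) : (D.comap jc).InOm j x ↔ D.InOm j (proj P jc 0 x) := by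
  unfold Domains.InOm
  rw [mem_comap_Om]
  by_cases hjk : j ≤ D.k
  · rw [proj_iterBlockOf P jc j (le_trans hjk D.hk)]
  · rw [D.Om_eq_empty (by omega)]
    simp

/-- `Deep` lifts: the `(j+1)`-block of `ỹ` lies in `Ω̃_{j+1}` iff that of `proj ỹ` lies in `Ω_{j+1}`. [cite: Balaban1984PropagatorsII, (2.3) p.224] -/
theorem deep_comap_iff (j : ℕ) (y : Site (cover P jc) j) : (D.comap jc).Deep j y ↔ D.Deep j (proj P jc j y) := by
  unfold Domains.Deep
  rw [mem_comap_Om]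
  by_cases hjk : j + 1 ≤ D.k
  · rw [proj_blockOf P jc j (le_trans hjk D.hk)]
  · rw [D.Om_eq_empty (by omega)]
    simp

/-- the site territories lift: `Λ̃_j = proj⁻¹ Λ_j`. [cite: Balaban1984PropagatorsII, (2.3) p.224] -/
theorem lamSite_comap_iff (j : ℕ) (y : Site (cover P jc) j) : (D.comap jc).LamSite j y ↔ D.LamSite j (proj P jc j y) := by
  unfold Domains.LamSite
  rw [mem_comap_Om, deep_comap_iff]

/-- the bond territories lift: `b̃ ∈ Λ̃_j ↔ projBond b̃ ∈ Λ_j`. [cite: Balaban1984PropagatorsII, (2.3) p.224] -/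
theorem lamBond_comap_iff (j : ℕ) (b : PBond (cover P jc) j) : (D.comap jc).LamBond j b ↔ D.LamBond j (projBond P jc j b) := by
  unfold Domains.LamBond
  rw [mem_comap_Om, mem_comap_Om, deep_comap_iff, deep_comap_iff, projBond_tgt]
  rfl

end Comap

/-! ## §2 Index bonds: the projection `projIdx`, its fibres (K-free cardinality), fibrewise sums -/

section Idx

variable {P : Params} (D : Domains P) (jc : ℕ)

/-- **THE PROJECTION OF INDEX BONDS** `BondIdx D̃ → BondIdx D`: keep the level, project the bond (territories lift by `lamBond_comap_iff`).
[cite: Balaban1984PropagatorsII, (2.3) p.224] -/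
def projIdx (c : BondIdx (D.comap jc)) : BondIdx D :=
  ⟨⟨c.1.1, projBond P jc (c.1.1 : ℕ) c.1.2⟩, (lamBond_comap_iff D jc _ _).1 c.2⟩

/-- `projIdx` keeps the level. [cite: Balaban1984PropagatorsII, (2.3) p.224] -/
@[simp] theorem projIdx_level (c : BondIdx (D.comap jc)) : (projIdx D jc c).1.1 = c.1.1 := rfl

/-- `projIdx` projects the bond. [cite: Balaban1984PropagatorsII, (2.3) p.224] -/
@[simp] theorem projIdx_bond (c : BondIdx (D.comap jc)) : (projIdx D jc c).1.2 = projBond P jc (c.1.1 : ℕ) c.1.2 := rfl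

/-- the source of the projected index bond. [cite: Balaban1984PropagatorsII, (2.3) p.224] -/
@[simp] theorem projIdx_src (c : BondIdx (D.comap jc)) : (projIdx D jc c).1.2.src = proj P jc (c.1.1 : ℕ) c.1.2.src := rfl

/-- the lift of an index bond at a lift of its bond. [cite: Balaban1984PropagatorsII, (2.3) p.224] -/
def liftIdx (c : BondIdx D) (b : PBond (cover P jc) (c.1.1 : ℕ)) (hb : projBond P jc (c.1.1 : ℕ) b = c.1.2) : BondIdx (D.comap jc) :=
  ⟨⟨c.1.1, b⟩, (lamBond_comap_iff D jc _ _).2 (by rw [hb]; exact c.2)⟩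

/-- `projIdx ∘ liftIdx = id`. [cite: Balaban1984PropagatorsII, (2.3) p.224] -/
@[simp] theorem projIdx_liftIdx (c : BondIdx D) (b : PBond (cover P jc) (c.1.1 : ℕ)) (hb : projBond P jc (c.1.1 : ℕ) b = c.1.2) :
    projIdx D jc (liftIdx D jc c b hb) = c := by
  apply Subtype.ext
  show (⟨c.1.1, projBond P jc (c.1.1 : ℕ) b⟩ : (j : Fin (D.k + 1)) × PBond P (j : ℕ)) = c.1
  rw [hb]

/-- `projIdx` is onto. [cite: Balaban1984PropagatorsII, (2.3) p.224] -/
theorem projIdx_surjective : Function.Surjective (projIdx D jc) := fun c => by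
  obtain ⟨b, hb⟩ := CoverSites.projBond_surjective P jc (c.1.1 : ℕ) c.1.2
  exact ⟨liftIdx D jc c b hb, projIdx_liftIdx D jc c b hb⟩

/-- **THE FIBRES OF `projIdx` HAVE `(L^{jc})^d` ELEMENTS — K-FREE** (kill test k-iv of the (α) plan: the deck index does not see `K`); the fibre over `c` is in
bijection with the bond fibre over `c`'s bond by `liftIdx`. [cite: Balaban1984PropagatorsII, (2.3) p.224] -/
theorem card_fibre_idx [DecidableEq (BondIdx D)] (c : BondIdx D) :
    (Finset.univ.filter fun c' : BondIdx (D.comap jc) => projIdx D jc c' = c).card = (P.L ^ jc) ^ P.d := by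
  classical
  have hlev : (c.1.1 : ℕ) ≤ P.m + P.K := le_trans (Nat.lt_succ_iff.1 c.1.1.isLt) D.hk
  have hb := card_fibre_bond P jc (c.1.1 : ℕ) hlev c.1.2
  rw [← hb]
  symm
  refine Finset.card_bij (fun b hb' => liftIdx D jc c b (Finset.mem_filter.1 hb').2) (fun b hb' => ?_) (fun b₁ hb₁ b₂ hb₂ h => ?_)
    (fun c' hc' => ?_)
  · exact Finset.mem_filter.2 ⟨Finset.mem_univ _, projIdx_liftIdx D jc c b _⟩
  · have h2 : (⟨c.1.1, b₁⟩ : (j : Fin (D.k + 1)) × PBond (cover P jc) (j : ℕ)) = ⟨c.1.1, b₂⟩ := congrArg Subtype.val h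
    exact eq_of_heq (Sigma.mk.inj_iff.1 h2).2
  · have hc := (Finset.mem_filter.1 hc').2
    subst hc
    obtain ⟨⟨j, b⟩, hjb⟩ := c'
    exact ⟨b, Finset.mem_filter.2 ⟨Finset.mem_univ _, rfl⟩, rfl⟩

/-- **SUMS OVER THE INDEX BONDS OF THE COVER REGROUP OVER THE FIBRES** (the letter-transfer workhorse of α5 on the `BondIdx` side).
[cite: Balaban1984PropagatorsII, (2.3) p.224] -/
theorem sum_idx_cover_eq_sum_fibre [DecidableEq (BondIdx D)] {M : Type*} [AddCommMonoid M] (f : BondIdx (D.comap jc) → M) :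
    ∑ c', f c' = ∑ c : BondIdx D, ∑ c' ∈ Finset.univ.filter (fun c' => projIdx D jc c' = c), f c' := by
  rw [← Finset.sum_fiberwise_of_maps_to (g := projIdx D jc) (t := Finset.univ) (fun _ _ => Finset.mem_univ _)]

/-- a fibre sum of a nonnegative function is at most the whole sum (one summand ≤ the orbit sum; the `RowSum162` transfer of α5 reads it backwards).
[cite: Balaban1985Variational, (162) p.303] -/
theorem le_sum_fibre_of_nonneg [DecidableEq (BondIdx D)] (f : BondIdx (D.comap jc) → ℝ) (hf : ∀ c', 0 ≤ f c') (c' : BondIdx (D.comap jc)) :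
    f c' ≤ ∑ c'' ∈ Finset.univ.filter (fun c'' => projIdx D jc c'' = projIdx D jc c'), f c'' :=
  Finset.single_le_sum (fun c'' _ => hf c'') (Finset.mem_filter.2 ⟨Finset.mem_univ _, rfl⟩)

end Idx

/-! ## §3 Levels and the P2 level weights lift -/

section Levels

variable {P : Params} (D : Domains P) (jc : ℕ)

/-- two domain sequences on two carriers that agree along a map have the same level at corresponding points. [cite: Balaban1985Variational, p.286] -/
theorem levOf_congr_of_iff {ι ι' : Type*} {Ω : ℕ → Set ι} {Ω' : ℕ → Set ι'} {k : ℕ} {x : ι} {x' : ι'}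
    (h : ∀ j, x ∈ Ω j ↔ x' ∈ Ω' j) : levOf Ω k x = levOf Ω' k x' := by
  classical
  obtain ⟨hmk, hPm, hmax⟩ := (Nat.findGreatest_eq_iff (P := fun j => x' ∈ Ω' j) (k := k) (m := levOf Ω' k x')).1 rfl
  unfold levOf
  rw [Nat.findGreatest_eq_iff]
  exact ⟨hmk, fun h0 => (h _).2 (hPm h0), fun n hmn hnk hn => hmax hmn hnk ((h n).1 hn)⟩

/-- **THE LEVEL MAP LIFTS**: `j(x̃) = j(proj x̃)` for the domain sequences of `D̃` and `D`. [cite: Balaban1985Variational, p.286] -/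
theorem levOf_comap (k : ℕ) (x : Site (cover P jc) 0) :
    levOf (fun j => {y : Site (cover P jc) 0 | (D.comap jc).InOm j y}) k x = levOf (fun j => {y : Site P 0 | D.InOm j y}) k (proj P jc 0 x) :=
  levOf_congr_of_iff fun j => by simpa using inOm_comap_iff D jc j x

end Levels

section T3

variable (F : T3Family) (n K : ℕ) (jc : ℕ) (D : Domains (F.P K))

/-- **THE P2 LEVEL WEIGHTS LIFT**: `w̃ m b̃ := w m (projBond b̃)` are the level weights of `D̃` for the covering member `F.cover jc` (same `L`, `n`, `K`).
[cite: Balaban1985Variational, p.286, (152) p.301] -/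
theorem isLevWeight_comap {w : ℕ → PBond (F.P K) 0 → ℝ} (hw : IsLevWeight F n K D w) :
    IsLevWeight (F.cover jc) n K (D.comap jc) (fun m b => w m (projBond (F.P K) jc 0 b)) := by
  intro m b
  change w m (projBond (F.P K) jc 0 b) =
    (((F.P K).L : ℝ) ^ levOf (fun j => {x : Site (cover (F.P K) jc) 0 | (D.comap jc).InOm j x}) (K - n) b.src * (((F.P K).L : ℝ)⁻¹) ^ (K - n)) ^ m
  rw [hw m, levOf_comap D jc (K - n) b.src]
  rfl

end T3

/-! ## §4 Admissibility (2.1)–(2.2) lifts -/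

section Adm

variable {P : Params} (D : Domains P) (jc : ℕ)

/-- `N ≤ M ∨ M ∣ N` for `M = Lᵃ`, `N = 2L^s` (`L ≥ 2`): the block size either divides the period or exceeds it. [folklore] -/
theorem sitesPerDir_le_or_dvd {M : ℕ} (hM : ∃ a, M = P.L ^ a) (j : ℕ) : P.sitesPerDir j ≤ M ∨ M ∣ P.sitesPerDir j := by
  obtain ⟨a, rfl⟩ := hM
  unfold Params.sitesPerDir
  set s := P.m + P.K - j
  by_cases has : a ≤ s
  · exact Or.inr (Dvd.dvd.mul_left (pow_dvd_pow _ has) 2)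
  · refine Or.inl ?_
    have hL : 2 ≤ P.L := P.hL.2
    calc 2 * P.L ^ s ≤ P.L * P.L ^ s := Nat.mul_le_mul_right _ hL
      _ = P.L ^ (s + 1) := by ring
      _ ≤ P.L ^ a := Nat.pow_le_pow_right (by omega) (by omega)

/-- the `M`-block labels of the projections agree when those of the lifts do (`M = Lᵃ`). [cite: Balaban1984PropagatorsII, (2.1) p.224] -/
theorem label_proj_eq {M : ℕ} (hM : ∃ a, M = P.L ^ a) (j : ℕ) (y y' : Site (cover P jc) j) (h : ∀ μ, (y μ).val / M = (y' μ).val / M)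
    (μ : Fin P.d) : (proj P jc j y μ).val / M = (proj P jc j y' μ).val / M := by
  rw [val_proj, val_proj]
  rcases sitesPerDir_le_or_dvd hM j with hle | ⟨q, hq⟩
  · -- both labels vanish: the projections' values are `< N ≤ M`
    have h1 : (y μ).val % P.sitesPerDir j / M = 0 := Nat.div_eq_of_lt (lt_of_lt_of_le (Nat.mod_lt _ (P.sitesPerDir_ne_zero j).bot_lt) hle)
    have h2 : (y' μ).val % P.sitesPerDir j / M = 0 := Nat.div_eq_of_lt (lt_of_lt_of_le (Nat.mod_lt _ (P.sitesPerDir_ne_zero j).bot_lt) hle)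
    rw [h1, h2]
  · -- `N = M·q`: `(v % (M q)) / M = (v / M) % q`
    rw [hq, Nat.mod_mul_right_div_self, Nat.mod_mul_right_div_self, h μ]

/-- **ADMISSIBILITY LIFTS**: if `D` is `(R, M)`-admissible with `M` a power of `L` (the shape `FlatOpsAdmAtMS` quantifies), so is `D̃` — (1) block-constancy of
membership via `label_proj_eq`, (2) the separation `dist_j(Ω_{j+1}, Ω_jᶜ) > R·M` because a reduction map can only shrink the circular distance (`distSite_proj_le`).
NO torus-size hypothesis. [cite: Balaban1984PropagatorsII, (2.1)-(2.2) p.224; Balaban1985RegularSpaces, (1.3)-(1.4) p.77] -/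
theorem adm22_comap {R M : ℕ} (hM : ∃ a, M = P.L ^ a) (hD : Adm22 D R M) : Adm22 (D.comap jc) R M := by
  refine ⟨fun j hj y y' hyy' => ?_, fun j y y' hy hy' => ?_⟩
  · rw [mem_comap_Om, mem_comap_Om]
    exact hD.1 j hj _ _ (label_proj_eq jc hM j y y' hyy')
  · have hjk : j + 1 ≤ D.k := by
      by_contra hlt
      rw [mem_comap_Om, D.Om_eq_empty (by omega)] at hy
      simp at hy
    rw [mem_comap_Om, proj_blockOf P jc j (le_trans hjk D.hk)] at hy
    rw [mem_comap_Om] at hy'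
    exact lt_of_lt_of_le (hD.2 j _ _ hy hy') (distSite_proj_le P jc j y y')

end Adm

/-! ## §5 The distance of (161) under the projection -/

section Dist

variable {P : Params} (D : Domains P) (jc : ℕ)

/-- **`d(b, c)` OF (161) CAN ONLY GROW UNDER LIFTING**: `distBI D (projBond b̃) (projIdx c̃) ≤ distBI D̃ b̃ c̃` (same unit factor `L^{j(c)−k}`; the level-`j(c)` circular
distance of the projections is at most that of the lifts). [cite: Balaban1985Variational, (161) p.303] -/
theorem distBI_proj_le (b : PBond (cover P jc) 0) (c : BondIdx (D.comap jc)) :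
    distBI D (projBond P jc 0 b) (projIdx D jc c) ≤ distBI (D.comap jc) b c := by
  have hlev : (c.1.1 : ℕ) ≤ P.m + P.K := le_trans (Nat.lt_succ_iff.1 c.1.1.isLt) D.hk
  unfold distBI
  simp only [projIdx_level, projIdx_src, CoverSites.projBond_src, comap_k]
  rw [← proj_iterBlockOf P jc _ hlev]
  exact mul_le_mul_of_nonneg_left (distSite_proj_le P jc _ _ _) (pow_nonneg (inv_nonneg.2 (Nat.cast_nonneg _)) _)

/-- … and the downstairs distance is ATTAINED on some lift of the index bond (so `min over the fibre = distBI D`, the admissible `dBI_small` of α5).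
[cite: Balaban1985Variational, (161) p.303] -/
theorem exists_lift_distBI_eq (b : PBond (cover P jc) 0) (c : BondIdx D) :
    ∃ c' : BondIdx (D.comap jc), projIdx D jc c' = c ∧ distBI (D.comap jc) b c' = distBI D (projBond P jc 0 b) c := by
  have hlev : (c.1.1 : ℕ) ≤ P.m + P.K := le_trans (Nat.lt_succ_iff.1 c.1.1.isLt) D.hk
  obtain ⟨y, hy, hdist⟩ := exists_lift_distSite_eq P jc (c.1.1 : ℕ) (iterBlockOf (c.1.1 : ℕ) b.src) c.1.2.src
  refine ⟨liftIdx D jc c ⟨y, c.1.2.dir⟩ ?_, projIdx_liftIdx D jc c _ _, ?_⟩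
  · cases c with
    | mk p hp => simp only [CoverSites.projBond, hy]
  · unfold distBI
    simp only [liftIdx, comap_k, CoverSites.projBond_src]
    rw [hdist, proj_iterBlockOf P jc _ hlev]

end Dist

end Summit.QuantumFields.YangMills.Theorems.CoverDomains

end
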